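import Literature.NumberTheory.LFunctions.MoebiusWalshTypeIIHypZero
import Literature.NumberTheory.LFunctions.MoebiusWalshAssembly
import HarnessLib

/-!
# The type-II hypothesis of the assembly: combining the bottom window with the shifted windows — proved

Topic `Literature/NumberTheory/LFunctions`, a proofs companion of `MoebiusWalshCircuits.lean`
(named facts `bourgain_moebius_walsh_uniform`, `bourgain_liouville_walsh_uniform`: J. Bourgain,
*Möbius–Walsh correlation bounds and an estimate of Mauduit and Rivat*, J. Anal. Math. **119**
(2013) 147–163 = arXiv:1109.2784 [Bourgain2013MoebiusWalsh], Theorem 1). Everything here is PROVED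
(theorems only; no definition, no named fact).

The assemblies `MoebiusWalsh.bourgain_moebius_walsh_uniform_of_typeII` (`MoebiusWalshAssembly.lean`)
and `MoebiusWalsh.bourgain_liouville_walsh_uniform_of_typeII` (`LiouvilleWalshAssemblyTwin.lean`)
take ONE hypothesis `∃ c > 0, ∃ C ≥ 0, TypeII c C` quantified over all admissible window origins
`K`. Its bottom-window half (`K = 0`) is the tree's `typeII_hyp_zero` (`MoebiusWalshTypeIIHypZero.lean`,
constants `c⋆ = min(1/2, θc₂, c₀/2)`, `C = 10`). This file reduces the whole hypothesis to its
SHIFTED-WINDOW half (`K > 0`, Bourgain §2 (2.23)–(2.27)), with arbitrary constants `c₁ > 0`,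
`C₁` of its own:

* `typeII_shape_mono` — the right-hand side `L^C (2^{-c g₀} + 2^{Cρ - ci} + 2^{Cρ - cd})` is
  antitone in `c` and monotone in `C` (`L ≥ 1`), so two halves with different constants combine
  with `c = min`, `C = max`;
* `typeII_hyp_of_high` — `(shifted-window half with (c₁, C₁)) → ∃ c > 0, ∃ C ≥ 0, TypeII c C`
  (`c = min c₁ c⋆`, `C = max C₁ 10`; the bottom window needs only `ρ ≤ j`, which follows from
  `Cρ ≤ i ≤ j`);
* `bourgain_moebius_walsh_uniform_of_high` — Theorem 1 for `μ` from the shifted-window half alone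
  (the `λ` twin is the same one-liner with `bourgain_liouville_walsh_uniform_of_typeII` of
  `LiouvilleWalshAssemblyTwin.lean`; `bourgain_liouville_walsh_uniform` is meanwhile discharged in
  `MoebiusWalshTypeIIHighBox.lean`, so it is not repeated here).

So the discharge of `bourgain_moebius_walsh_uniform` is now EXACTLY the shifted-window per-box
estimate in the displayed shape (supplied in `MoebiusWalshTypeIIHypHigh.lean`).

## References

* J. Bourgain, J. Anal. Math. 119 (2013) 147–163; arXiv:1109.2784, §2 (2.22)–(2.29).
  [Bourgain2013MoebiusWalsh]
-/

noncomputable section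

open Finset Real

namespace Literature.NumberTheory.LFunctions.MoebiusWalsh

open Literature.NumberTheory.LFunctions.MoebiusWalshVaughan (boxSum)
open Literature.NumberTheory.LFunctions.MoebiusWalshTypeII (typeIIGap typeIITheta typeIIGap_pos
  typeIITheta_pos)

/-- **Monotonicity of the type-II shape in its constants**: for `L ≥ 1`, `g₀, i, d, ρ ≥ 0`,
`c ≤ c'` and `C' ≤ C`,
`L^{C'}(2^{-c'g₀} + 2^{C'ρ - c'i} + 2^{C'ρ - c'd}) ≤ L^{C}(2^{-cg₀} + 2^{Cρ - ci} + 2^{Cρ - cd})`.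
[folklore] -/
theorem typeII_shape_mono {L c c' C C' g₀ i d ρ : ℝ} (hL : 1 ≤ L) (hg₀ : 0 ≤ g₀) (hi : 0 ≤ i)
    (hd : 0 ≤ d) (hρ : 0 ≤ ρ) (hcc : c ≤ c') (hCC : C' ≤ C) :
    L ^ C' * ((2 : ℝ) ^ (-(c' * g₀)) + (2 : ℝ) ^ (C' * ρ - c' * i) + (2 : ℝ) ^ (C' * ρ - c' * d)) ≤
      L ^ C * ((2 : ℝ) ^ (-(c * g₀)) + (2 : ℝ) ^ (C * ρ - c * i) + (2 : ℝ) ^ (C * ρ - c * d)) := by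
  have hL0 : 0 ≤ L := by linarith
  have h1 : L ^ C' ≤ L ^ C := Real.rpow_le_rpow_of_exponent_le hL hCC
  have e1 := mul_le_mul_of_nonneg_right hcc hg₀
  have e2 := mul_le_mul_of_nonneg_right hcc hi
  have e3 := mul_le_mul_of_nonneg_right hcc hd
  have e4 := mul_le_mul_of_nonneg_right hCC hρ
  have t1 : (2 : ℝ) ^ (-(c' * g₀)) ≤ (2 : ℝ) ^ (-(c * g₀)) :=
    Real.rpow_le_rpow_of_exponent_le one_le_two (by linarith only [e1])
  have t2 : (2 : ℝ) ^ (C' * ρ - c' * i) ≤ (2 : ℝ) ^ (C * ρ - c * i) :=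
    Real.rpow_le_rpow_of_exponent_le one_le_two (by linarith only [e2, e4])
  have t3 : (2 : ℝ) ^ (C' * ρ - c' * d) ≤ (2 : ℝ) ^ (C * ρ - c * d) :=
    Real.rpow_le_rpow_of_exponent_le one_le_two (by linarith only [e3, e4])
  exact mul_le_mul h1 (by linarith) (by positivity) (Real.rpow_nonneg hL0 _)

/-- **The full type-II hypothesis from its shifted-window half.** If the shifted windows `K > 0`
(middle: `K + w + 1 ≤ j`; top: `j + 2 ≤ K + w ∧ K + ρ ≤ j`; `w = ρ + g₀ + 1`, `i ≤ K + ρ`) obey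
the shape with some constants `c₁ > 0`, `C₁` (real), then the hypothesis of
`bourgain_moebius_walsh_uniform_of_typeII` / `bourgain_liouville_walsh_uniform_of_typeII` holds
(the bottom window being `typeII_hyp_zero`). [cite: Bourgain2013MoebiusWalsh, §2 (2.22)–(2.29)] -/
theorem typeII_hyp_of_high {c₁ C₁ : ℝ} (hc₁ : 0 < c₁)
    (hhigh : ∀ (i j ρ g₀ K : ℕ) (T : Finset ℕ) (α β : ℕ → ℝ),
      i ≤ j → 1 ≤ g₀ → g₀ ≤ ρ → C₁ * ρ ≤ i →
      (∀ t ∈ T, t < i + j + 2) →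
      0 < K → i ≤ K + ρ →
      (K + (ρ + g₀ + 1) + 1 ≤ j ∨ (j + 2 ≤ K + (ρ + g₀ + 1) ∧ K + ρ ≤ j)) →
      (∀ a, |α a| ≤ 1) → (∀ b, |β b| ≤ 1) →
      |boxSum T i j α β| ≤ 2 ^ (i + j) * ((i : ℝ) + j + 2) ^ C₁ *
        ((2 : ℝ) ^ (-(c₁ * g₀)) + (2 : ℝ) ^ (C₁ * ρ - c₁ * i) +
          (2 : ℝ) ^ (C₁ * ρ - c₁ * ((T.filter (fun t => K ≤ t ∧ t < K + i + (ρ + g₀ + 1))).card : ℝ)))) :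
    ∃ c : ℝ, 0 < c ∧ ∃ C : ℝ, 0 ≤ C ∧
      ∀ (i j ρ g₀ K : ℕ) (T : Finset ℕ) (α β : ℕ → ℝ),
      i ≤ j → 1 ≤ g₀ → g₀ ≤ ρ → C * ρ ≤ i →
      (∀ t ∈ T, t < i + j + 2) →
      (K = 0 ∨ i ≤ K + ρ) →
      (K + (ρ + g₀ + 1) + 1 ≤ j ∨ (j + 2 ≤ K + (ρ + g₀ + 1) ∧ K + ρ ≤ j)) →
      (∀ a, |α a| ≤ 1) → (∀ b, |β b| ≤ 1) →
      |boxSum T i j α β| ≤ 2 ^ (i + j) * ((i : ℝ) + j + 2) ^ C *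
        ((2 : ℝ) ^ (-(c * g₀)) + (2 : ℝ) ^ (C * ρ - c * i) +
          (2 : ℝ) ^ (C * ρ - c * ((T.filter (fun t => K ≤ t ∧ t < K + i + (ρ + g₀ + 1))).card : ℝ))) := by
  set cz : ℝ := min (1 / 2) (min (typeIITheta * walshSupExponent) (typeIIGap / 2)) with hcz
  have hcz0 : 0 < cz := by
    rw [hcz]
    have := typeIITheta_pos; have := walshSupExponent_pos; have := typeIIGap_pos
    positivity
  refine ⟨min c₁ cz, lt_min hc₁ hcz0, max C₁ 10, le_max_of_le_right (by norm_num), ?_⟩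
  intro i j ρ g₀ K T α β hij hg₀ hg₀ρ hCρ hT hK1 hK2 hα hβ
  have hL : (1 : ℝ) ≤ (i : ℝ) + j + 2 := by
    have : (0 : ℝ) ≤ (i : ℝ) + j := by positivity
    linarith
  have hρ0 : (0 : ℝ) ≤ ρ := Nat.cast_nonneg _
  have hi0 : (0 : ℝ) ≤ i := Nat.cast_nonneg _
  have hg0 : (0 : ℝ) ≤ g₀ := Nat.cast_nonneg _
  have hd0 : (0 : ℝ) ≤ ((T.filter (fun t => K ≤ t ∧ t < K + i + (ρ + g₀ + 1))).card : ℝ) :=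
    Nat.cast_nonneg _
  have h10 : (10 : ℝ) ≤ max C₁ 10 := le_max_right _ _
  have hC₁' : C₁ ≤ max C₁ 10 := le_max_left _ _
  rcases Nat.eq_zero_or_pos K with hK0 | hKpos
  · -- the bottom window
    subst hK0
    have hρj : ρ ≤ j := by
      have h0 : (10 : ℝ) * ρ ≤ max C₁ 10 * ρ := mul_le_mul_of_nonneg_right h10 hρ0
      have h1 : (ρ : ℝ) ≤ i := by linarith only [h0, hCρ, hρ0]
      have h2 : ρ ≤ i := by exact_mod_cast h1
      exact h2.trans hij
    have hz := typeII_hyp_zero i j ρ g₀ T α β hij hg₀ hg₀ρ hρj hα hβ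
    refine hz.trans ?_
    rw [mul_assoc, mul_assoc]
    refine mul_le_mul_of_nonneg_left ?_ (by positivity)
    exact typeII_shape_mono (c := min c₁ cz) (c' := cz) (C := max C₁ 10) (C' := 10) hL hg0 hi0 hd0 hρ0
      (min_le_right _ _) h10
  · -- a shifted window
    have hiK : i ≤ K + ρ := by
      rcases hK1 with h | h
      · omega
      · exact h
    have hC₁ρ : C₁ * ρ ≤ i := le_trans (mul_le_mul_of_nonneg_right hC₁' hρ0) hCρ
    have hh := hhigh i j ρ g₀ K T α β hij hg₀ hg₀ρ hC₁ρ hT hKpos hiK hK2 hα hβ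
    refine hh.trans ?_
    rw [mul_assoc, mul_assoc]
    refine mul_le_mul_of_nonneg_left ?_ (by positivity)
    exact typeII_shape_mono (c := min c₁ cz) (c' := c₁) (C := max C₁ 10) (C' := C₁) hL hg0 hi0 hd0 hρ0
      (min_le_left _ _) hC₁'

/-- **Bourgain 2013, Theorem 1 for `μ` from the shifted-window type-II estimate alone.**
[cite: Bourgain2013MoebiusWalsh, Theorem 1, §2 (2.23)–(2.29)] -/
theorem bourgain_moebius_walsh_uniform_of_high {c₁ C₁ : ℝ} (hc₁ : 0 < c₁)
    (hhigh : ∀ (i j ρ g₀ K : ℕ) (T : Finset ℕ) (α β : ℕ → ℝ),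
      i ≤ j → 1 ≤ g₀ → g₀ ≤ ρ → C₁ * ρ ≤ i →
      (∀ t ∈ T, t < i + j + 2) →
      0 < K → i ≤ K + ρ →
      (K + (ρ + g₀ + 1) + 1 ≤ j ∨ (j + 2 ≤ K + (ρ + g₀ + 1) ∧ K + ρ ≤ j)) →
      (∀ a, |α a| ≤ 1) → (∀ b, |β b| ≤ 1) →
      |boxSum T i j α β| ≤ 2 ^ (i + j) * ((i : ℝ) + j + 2) ^ C₁ *
        ((2 : ℝ) ^ (-(c₁ * g₀)) + (2 : ℝ) ^ (C₁ * ρ - c₁ * i) +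
          (2 : ℝ) ^ (C₁ * ρ - c₁ * ((T.filter (fun t => K ≤ t ∧ t < K + i + (ρ + g₀ + 1))).card : ℝ)))) :
    bourgain_moebius_walsh_uniform :=
  bourgain_moebius_walsh_uniform_of_typeII (typeII_hyp_of_high hc₁ hhigh)

end Literature.NumberTheory.LFunctions.MoebiusWalsh
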